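import Summits.CriticalPhenomena.PercolationContinuityZ3.Theorems.PercNearOneGluingNoHeavyQuantSliceClosure
import HarnessLib

/-!
# QUANT lane R8, T-DEC: conjecture SL in the product-Bernoulli blob vocabulary — `blobDEC_on_of_sliceClosed`

builds on p205010 (kernel theorem, internal audit signed; external expert review pending)

Support file (`--supports stmt-CriticalPhenomena-4575`), QUANT lane seat prim-quant-census-2 (gen 53), rung R8 of
`run/shared/lean/prim/quant/LADDER.md`.  Follow-up to `…QuantSliceClosure` (p266162).  One definition (`LawDec.blobLawOn`, the count law of a
finite family of independent heavy blobs written as a sum over open-sets, the shape of `FairCoin.decAt_half` / DEC-TAMP-G50's blob systems),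
theorems with standard axioms.

* `LawDec.blobLawOn s a p` — `h ↦ Σ_{W ⊆ s} (∏_{i ∈ s} (p i if i ∈ W else 1 − p i))·[Σ_{i ∈ W} a i = h]` (blobs `i ∈ s` of size `a i`, gate `p i`).
* `blobLawOn_empty`, `blobLawOn_insert` (inserting a blob = one `LawDec.slice`), `exists_blobLaw_eq` (every `blobLawOn` is a list blob law
  `LawDec.blobLaw` with top `Σ a i`).
* **`LawDec.blobDEC_on_of_sliceClosed : SliceClosed → ∀ x ∈ (0,1), ∀ s a p (1 ≤ a i, x ≤ p i < 1 on s), ∀ j′, DECAt x j′ (Σ_{i∈s} a i) (blobLawOn s a p)`**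
  — BLOB-DEC(k) for every `k` (DEC-TAMP-G50 §3.7, the census's blob systems) from conjecture SL.

[this work]; DEC rules ARCH-TREES-G49 §2.2 / DEC-TAMP-G50 §3.1 (this lane).  The gluing rows served [cite: KozmaNitzan2024, Conjecture 3 (p. 15)];
product measure [cite: Grimmett1999, §1.3 p. 10].
-/

noncomputable section

namespace Summit.CriticalPhenomena.PercolationContinuityZ3.Theorems

namespace Quant

open Finset

namespace LawDec

variable {ι : Type*} [DecidableEq ι]

/-- **Count law of the independent blobs `i ∈ s`** (size `a i`, gate `p i`), as a sum over the open-set `W ⊆ s`. [this work] -/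
def blobLawOn (s : Finset ι) (a : ι → ℕ) (p : ι → ℝ) : ℕ → ℝ :=
  fun h => ∑ W ∈ s.powerset, (∏ i ∈ s, if i ∈ W then p i else 1 - p i) * (if ∑ i ∈ W, a i = h then (1 : ℝ) else 0)

/-- no blobs: the point mass at `0`. [this work] -/
theorem blobLawOn_empty (a : ι → ℕ) (p : ι → ℝ) :
    blobLawOn (∅ : Finset ι) a p = fun h => if h = 0 then (1 : ℝ) else 0 := by
  funext h
  simp only [blobLawOn, Finset.powerset_empty, Finset.sum_singleton, Finset.prod_empty, Finset.sum_empty, one_mul]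
  by_cases h0 : h = 0
  · rw [if_pos h0.symm, if_pos h0]
  · rw [if_neg (Ne.symm h0), if_neg h0]

/-- **inserting a blob is a slice**: `blobLawOn (insert i₀ s) = slice (blobLawOn s) (a i₀) (p i₀)` for `i₀ ∉ s`. [this work] -/
theorem blobLawOn_insert (s : Finset ι) (i₀ : ι) (hi : i₀ ∉ s) (a : ι → ℕ) (p : ι → ℝ) :
    blobLawOn (insert i₀ s) a p = slice (blobLawOn s a p) (a i₀) (p i₀) := by
  funext h
  simp only [blobLawOn, slice]
  rw [Finset.sum_powerset_insert hi]
  -- open-sets not containing `i₀`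
  have e1 : ∀ W ∈ s.powerset, (∏ i ∈ insert i₀ s, if i ∈ W then p i else 1 - p i)
      = (1 - p i₀) * ∏ i ∈ s, if i ∈ W then p i else 1 - p i := by
    intro W hW
    have hW' : i₀ ∉ W := fun hm => hi (Finset.mem_powerset.1 hW hm)
    rw [Finset.prod_insert hi, if_neg hW']
  -- open-sets containing `i₀`
  have e2 : ∀ W ∈ s.powerset, (∏ i ∈ insert i₀ s, if i ∈ insert i₀ W then p i else 1 - p i)
      = p i₀ * ∏ i ∈ s, if i ∈ W then p i else 1 - p i := by
    intro W hW
    rw [Finset.prod_insert hi, if_pos (Finset.mem_insert_self i₀ W)]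
    congr 1
    refine Finset.prod_congr rfl fun i his => ?_
    have hne : i ≠ i₀ := fun e => hi (e ▸ his)
    simp only [Finset.mem_insert, hne, false_or]
  have e3 : ∀ W ∈ s.powerset, (∑ i ∈ insert i₀ W, a i) = a i₀ + ∑ i ∈ W, a i := by
    intro W hW
    have hW' : i₀ ∉ W := fun hm => hi (Finset.mem_powerset.1 hW hm)
    rw [Finset.sum_insert hW']
  have s1 : ∑ W ∈ s.powerset, (∏ i ∈ insert i₀ s, if i ∈ W then p i else 1 - p i) * (if ∑ i ∈ W, a i = h then (1 : ℝ) else 0)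
      = (1 - p i₀) * ∑ W ∈ s.powerset, (∏ i ∈ s, if i ∈ W then p i else 1 - p i) * (if ∑ i ∈ W, a i = h then (1 : ℝ) else 0) := by
    rw [Finset.mul_sum]
    refine Finset.sum_congr rfl fun W hW => ?_
    rw [e1 W hW, mul_assoc]
  have s2 : ∑ W ∈ s.powerset, (∏ i ∈ insert i₀ s, if i ∈ insert i₀ W then p i else 1 - p i)
        * (if ∑ i ∈ insert i₀ W, a i = h then (1 : ℝ) else 0)
      = p i₀ * (if a i₀ ≤ h then
          ∑ W ∈ s.powerset, (∏ i ∈ s, if i ∈ W then p i else 1 - p i) * (if ∑ i ∈ W, a i = h - a i₀ then (1 : ℝ) else 0) else 0) := by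
    by_cases ha : a i₀ ≤ h
    · rw [if_pos ha, Finset.mul_sum]
      refine Finset.sum_congr rfl fun W hW => ?_
      rw [e2 W hW, e3 W hW, mul_assoc]
      have : (a i₀ + ∑ i ∈ W, a i = h) ↔ (∑ i ∈ W, a i = h - a i₀) := by omega
      simp only [this]
    · rw [if_neg ha, mul_zero]
      refine Finset.sum_eq_zero fun W hW => ?_
      rw [e3 W hW, if_neg (by omega), mul_zero]
  rw [s1, s2]

/-- every `blobLawOn` is a list blob law (`LawDec.blobLaw`) over the same blobs, with top `Σ a i`. [this work] -/
theorem exists_blobLaw_eq (s : Finset ι) (a : ι → ℕ) (p : ι → ℝ) :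
    ∃ l : List (ℕ × ℝ), (∀ q ∈ l, ∃ i ∈ s, q = (a i, p i)) ∧ blobLaw l = blobLawOn s a p ∧ blobTop l = ∑ i ∈ s, a i := by
  induction s using Finset.induction_on with
  | empty => exact ⟨[], by simp, by rw [blobLawOn_empty]; rfl, by simp [blobTop]⟩
  | @insert i₀ s hi ih =>
    obtain ⟨l, hl, hlaw, htop⟩ := ih
    refine ⟨(a i₀, p i₀) :: l, ?_, ?_, ?_⟩
    · intro q hq
      rcases List.mem_cons.1 hq with rfl | hq'
      · exact ⟨i₀, Finset.mem_insert_self _ _, rfl⟩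
      · obtain ⟨i, his, e⟩ := hl q hq'
        exact ⟨i, Finset.mem_insert_of_mem his, e⟩
    · show slice (blobLaw l) (a i₀) (p i₀) = blobLawOn (insert i₀ s) a p
      rw [hlaw, blobLawOn_insert s i₀ hi]
    · show blobTop l + a i₀ = ∑ i ∈ insert i₀ s, a i
      rw [Finset.sum_insert hi, htop, add_comm]

/-- **BLOB-DEC(k) FOR EVERY k, PRODUCT-BERNOULLI FORM, FROM CONJECTURE SL.**  For `0 < x < 1` and blobs `i ∈ s` with sizes `a i ≥ 1` and gates
`x ≤ p i < 1`, the count law `blobLawOn s a p` is DEC(j′) at floor `x` for every layer `j′`. [this work] -/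
theorem blobDEC_on_of_sliceClosed (hSL : SliceClosed) (x : ℝ) (hx0 : 0 < x) (hx1 : x < 1) (s : Finset ι) (a : ι → ℕ) (p : ι → ℝ)
    (hs : ∀ i ∈ s, 1 ≤ a i ∧ x ≤ p i ∧ p i < 1) (j' : ℕ) :
    DECAt x j' (∑ i ∈ s, a i) (blobLawOn s a p) := by
  obtain ⟨l, hl, hlaw, htop⟩ := exists_blobLaw_eq s a p
  rw [← hlaw, ← htop]
  refine blobDEC_of_sliceClosed hSL x hx0 hx1 l (fun q hq => ?_) j'
  obtain ⟨i, his, e⟩ := hl q hq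
  rw [e]
  exact hs i his

end LawDec

end Quant

end Summit.CriticalPhenomena.PercolationContinuityZ3.Theorems
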